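import Summits.QuantumFields.YangMills.Theorems.ColdStartUniversalityLatticeLangevinTransportMixing
import Summits.QuantumFields.YangMills.Theorems.ColdStartUniversalityLatticeLangevinWilsonEntropyDecayLaw
import HarnessLib

/-!
# Route `ColdStartUniversality` (fixed-cut-off package): TRANSPORT–ENTROPY MIXING FROM A LOG-SOBOLEV INEQUALITY WITH AN ARBITRARY CONSTANT
# — the `ρ`-parametric form of `…BakryEmeryConcentration` / `…TransportMixing`, valid at EVERY coupling `β'`

Helper file (seat `ym-line-csu-p1`, g28; `--supports stmt-QuantumFields-24809`).  g26/g28 hard-wire the volume-uniform Bakry–Émery constant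
`ρ = (1 − 12|β'|)/2` (`|β'| < 1/12`).  Here the SAME chain is run from a HYPOTHESIS: a generator-form log-Sobolev inequality
`ρ·Ent_(μ_β')(F²) ≤ −∫ F·𝓛_(β')f dμ_(β')` on `C³` cylinders with some constant `ρ > 0` (the shape `hLSgen` of g22's
`klDiv_map_le_exp_of_generatorLogSobolev`, and — at the cut-off coupling with `ρ = c·ε_K` — the inner statement of the route's K-uniform
hypothesis (ULS) of LINE 4 «cold_entropy»).  For `f ∈ C³` with carré du champ `Γ(f) ≤ s`:
* ★ `wilson_entropy_exp_le_of_logSobolev` — `Ent(e^(λF)) ≤ (sλ²/(8ρ)) ∫ e^(λF)` (`λ > 0`);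
* ★ `wilson_laplace_le_exp_of_logSobolev` / `_real` — `∫ e^(λF) dμ ≤ exp(λ μF + sλ²/(8ρ))` (Herbst), every real `λ`;
(the log-mgf form, concentration, the transport–entropy inequality `|∫F dν − ∫F dμ| ≤ √(s·KL(ν ‖ μ)/(2ρ))` and the cold-start bound
`|E F(U_(τ₀+u)) − μF| ≤ e^(−2ρu)·√(s·KL(law U_(τ₀) ‖ μ)/(2ρ))` are in the sequel `…TransportMixingOfLogSobolevColdStart`).
[cite: BakryGentilLedoux2014, Thm 5.2.1]  HONEST FRAMING: FIXED cut-off; the log-Sobolev inequality is a HYPOTHESIS here (proved in the tree only with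
`ρ = (1−12|β'|)/2` at `|β'| < 1/12` and with Holley–Stroock's `ρ = ½e^(−4|β'|#𝒫)` at every `β'`); nothing K-uniform; 24809 ASIDE not restated; no crux,
rung or summit statement is proved; the Yang–Mills mass gap is NOT proved.  THEOREMS ONLY, no definition, no sorry.
-/

set_option autoImplicit false

noncomputable section

namespace Summit.QuantumFields.YangMills.Theorems.ColdStartUniversality

open MeasureTheory ProbabilityTheory Finset Filter Set Metric InformationTheory
open scoped BigOperators NNReal ENNReal Topology
open Literature.Probability.Process Literature.MathematicalPhysics.QuantumFieldTheory
open Literature.MathematicalPhysics.QuantumLattice (fundamentalRep fundamentalLatticeRep continuous_fundamentalRep)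

variable {L : ℕ} [NeZero L]

/-! ## §1. Log-Sobolev with constant `ρ` ⇒ entropy bound for exponential moments -/

/-- ★ **Entropy bound for exponential moments from a log-Sobolev inequality with constant `ρ`.**  If `ρ·Ent_(μ_β')(G²) ≤ −∫ G·𝓛g dμ_(β')`
for all `C³` cylinders, then for `f ∈ C³` with `Γ(f) ≤ s` and `λ > 0`: `Ent_(μ_β')(e^(λF)) ≤ (sλ²/(8ρ)) ∫ e^(λF) dμ_(β')`
(`g = e^(λf/2)`, energy identity `−∫G·𝓛g = ½∫Γ(g)`, chain rule `Γ(e^(λf/2)) = (λ²/4)e^(λf)Γ(f)`). [cite: BakryGentilLedoux2014, Thm 5.2.1] -/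
theorem wilson_entropy_exp_le_of_logSobolev (L : ℕ) [NeZero L] (β' : ℝ)
    (f : (Edge 3 L × Fin 2 × Fin 2 × Bool → ℝ) → ℝ) (hf : ContDiff ℝ 3 f) (s : ℝ) {ρ : ℝ} (hρ : 0 < ρ)
    (hLSgen : ∀ (f : (Edge 3 L × Fin 2 × Fin 2 × Bool → ℝ) → ℝ), ContDiff ℝ 3 f →
        let coords : GaugeConfig 3 L (Matrix.specialUnitaryGroup (Fin 2) ℂ) → (Edge 3 L × Fin 2 × Fin 2 × Bool → ℝ) :=
          fun V q => (fun z : ℂ => if q.2.2.2 then z.im else z.re)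
            ((fundamentalRep (Fin 2) (V q.1) : Matrix (Fin 2) (Fin 2) ℂ) q.2.1 q.2.2.1)
        let gen : GaugeConfig 3 L (Matrix.specialUnitaryGroup (Fin 2) ℂ) → ℝ := fun V =>
          (∑ i : Edge 3 L × Fin 2 × Fin 2 × Bool, fderiv ℝ f (coords V) (Pi.single i 1) *
              (fun z : ℂ => if i.2.2.2 then z.im else z.re)
                ((latticeLangevinDynamics (fundamentalLatticeRep 2) β').drift
                  (matrixConfig (fundamentalRep (Fin 2)) V) i.1 i.2.1 i.2.2.1) +
          1 / 2 * ∑ i : Edge 3 L × Fin 2 × Fin 2 × Bool, ∑ j : Edge 3 L × Fin 2 × Fin 2 × Bool,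
            fderiv ℝ (fun z => fderiv ℝ f z (Pi.single i 1)) (coords V) (Pi.single j 1) *
              ∑ n : Edge 3 L × NoiseIdx 2,
                (if n.1 = i.1 then (fun z : ℂ => if i.2.2.2 then z.im else z.re)
                  ((latticeLangevinDynamics (fundamentalLatticeRep 2) β').noise
                    (matrixConfig (fundamentalRep (Fin 2)) V) i.1 n.2 i.2.1 i.2.2.1) else 0) *
                (if n.1 = j.1 then (fun z : ℂ => if j.2.2.2 then z.im else z.re)
                  ((latticeLangevinDynamics (fundamentalLatticeRep 2) β').noise
                    (matrixConfig (fundamentalRep (Fin 2)) V) j.1 n.2 j.2.1 j.2.2.1) else 0))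
        ρ * ((∫ V, f (coords V) ^ 2 * Real.log (f (coords V) ^ 2) ∂(wilsonMeasure (d := 3) (L := L) (fundamentalRep (Fin 2)) β')) -
            (∫ V, f (coords V) ^ 2 ∂(wilsonMeasure (d := 3) (L := L) (fundamentalRep (Fin 2)) β')) *
              Real.log (∫ V, f (coords V) ^ 2 ∂(wilsonMeasure (d := 3) (L := L) (fundamentalRep (Fin 2)) β'))) ≤
          -∫ V, f (coords V) * gen V ∂(wilsonMeasure (d := 3) (L := L) (fundamentalRep (Fin 2)) β')) :
    let coords : GaugeConfig 3 L (Matrix.specialUnitaryGroup (Fin 2) ℂ) → (Edge 3 L × Fin 2 × Fin 2 × Bool → ℝ) :=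
      fun V q => (fun z : ℂ => if q.2.2.2 then z.im else z.re)
        ((fundamentalRep (Fin 2) (V q.1) : Matrix (Fin 2) (Fin 2) ℂ) q.2.1 q.2.2.1)
    let A : GaugeConfig 3 L (Matrix.specialUnitaryGroup (Fin 2) ℂ) → (Edge 3 L × Fin 2 × Fin 2 × Bool) →
        (Edge 3 L × Fin 2 × Fin 2 × Bool) → ℝ := fun V i j =>
      ∑ n : Edge 3 L × NoiseIdx 2,
        (if n.1 = i.1 then (fun z : ℂ => if i.2.2.2 then z.im else z.re)
          ((latticeLangevinDynamics (fundamentalLatticeRep 2) β').noise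
            (matrixConfig (fundamentalRep (Fin 2)) V) i.1 n.2 i.2.1 i.2.2.1) else 0) *
        (if n.1 = j.1 then (fun z : ℂ => if j.2.2.2 then z.im else z.re)
          ((latticeLangevinDynamics (fundamentalLatticeRep 2) β').noise
            (matrixConfig (fundamentalRep (Fin 2)) V) j.1 n.2 j.2.1 j.2.2.1) else 0)
    (∀ V, (∑ i : Edge 3 L × Fin 2 × Fin 2 × Bool, ∑ j : Edge 3 L × Fin 2 × Fin 2 × Bool, fderiv ℝ f (coords V) (Pi.single i 1) * fderiv ℝ f (coords V) (Pi.single j 1) * A V i j) ≤ s) → ∀ l : ℝ, 0 < l →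
      (∫ V, (l * f (coords V)) * Real.exp (l * f (coords V)) ∂(wilsonMeasure (d := 3) (L := L) (fundamentalRep (Fin 2)) β')) -
          (∫ V, Real.exp (l * f (coords V)) ∂(wilsonMeasure (d := 3) (L := L) (fundamentalRep (Fin 2)) β')) * Real.log (∫ V, Real.exp (l * f (coords V)) ∂(wilsonMeasure (d := 3) (L := L) (fundamentalRep (Fin 2)) β')) ≤
        s / (8 * ρ) * l ^ 2 * ∫ V, Real.exp (l * f (coords V)) ∂(wilsonMeasure (d := 3) (L := L) (fundamentalRep (Fin 2)) β') := by
  intro coords A hΓ l hl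
  classical
  haveI := secondCountableTopology_su2
  haveI := borelSpace_config L
  set μ : Measure (GaugeConfig 3 L (Matrix.specialUnitaryGroup (Fin 2) ℂ)) := (wilsonMeasure (d := 3) (L := L) (fundamentalRep (Fin 2)) β') with hμ
  haveI : IsProbabilityMeasure μ :=
    isProbabilityMeasure_wilsonMeasure (d := 3) (L := L) (fundamentalRep (Fin 2)) (continuous_fundamentalRep (Fin 2)) β'
  have hco : Continuous coords := continuous_coords (L := L)
  let gen : ((Edge 3 L × Fin 2 × Fin 2 × Bool → ℝ) → ℝ) → GaugeConfig 3 L (Matrix.specialUnitaryGroup (Fin 2) ℂ) → ℝ :=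
    fun h V =>
    (∑ i : Edge 3 L × Fin 2 × Fin 2 × Bool, fderiv ℝ h (coords V) (Pi.single i 1) *
        (fun z : ℂ => if i.2.2.2 then z.im else z.re)
          ((latticeLangevinDynamics (fundamentalLatticeRep 2) β').drift
            (matrixConfig (fundamentalRep (Fin 2)) V) i.1 i.2.1 i.2.2.1) +
    1 / 2 * ∑ i : Edge 3 L × Fin 2 × Fin 2 × Bool, ∑ j : Edge 3 L × Fin 2 × Fin 2 × Bool,
      fderiv ℝ (fun z => fderiv ℝ h z (Pi.single i 1)) (coords V) (Pi.single j 1) *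
        ∑ n : Edge 3 L × NoiseIdx 2,
          (if n.1 = i.1 then (fun z : ℂ => if i.2.2.2 then z.im else z.re)
            ((latticeLangevinDynamics (fundamentalLatticeRep 2) β').noise
              (matrixConfig (fundamentalRep (Fin 2)) V) i.1 n.2 i.2.1 i.2.2.1) else 0) *
          (if n.1 = j.1 then (fun z : ℂ => if j.2.2.2 then z.im else z.re)
            ((latticeLangevinDynamics (fundamentalLatticeRep 2) β').noise
              (matrixConfig (fundamentalRep (Fin 2)) V) j.1 n.2 j.2.1 j.2.2.1) else 0))
  -- the test function `g = e^(λ f / 2)` and a compactly supported copy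
  set g : (Edge 3 L × Fin 2 × Fin 2 × Bool → ℝ) → ℝ := fun z => Real.exp (l / 2 * f z) with hgdef
  have hg : ContDiff ℝ 3 g := Real.contDiff_exp.comp (contDiff_const.mul hf)
  let χ : ContDiffBump (0 : (Edge 3 L × Fin 2 × Fin 2 × Bool → ℝ)) := ⟨2, 3, by norm_num, by norm_num⟩
  set g₁ : (Edge 3 L × Fin 2 × Fin 2 × Bool → ℝ) → ℝ := fun y => (χ : (Edge 3 L × Fin 2 × Fin 2 × Bool → ℝ) → ℝ) y * g y with hg₁def
  have hg₁ : ContDiff ℝ 3 g₁ := χ.contDiff.mul hg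
  have hg₁c : HasCompactSupport g₁ := χ.hasCompactSupport.mul_right
  have hball : ∀ V : (GaugeConfig 3 L (Matrix.specialUnitaryGroup (Fin 2) ℂ)), coords V ∈ ball (0 : (Edge 3 L × Fin 2 × Fin 2 × Bool → ℝ)) 2 := by
    intro V
    rw [mem_ball, dist_zero_right]
    exact (norm_coords_le_one V).trans_lt (by norm_num)
  have hg₁ev : ∀ V : (GaugeConfig 3 L (Matrix.specialUnitaryGroup (Fin 2) ℂ)), g₁ =ᶠ[𝓝 (coords V)] g := by
    intro V
    filter_upwards [isOpen_ball.mem_nhds (hball V)] with z hz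
    have h1 : (χ : (Edge 3 L × Fin 2 × Fin 2 × Bool → ℝ) → ℝ) z = 1 := χ.one_of_mem_closedBall (ball_subset_closedBall hz)
    simp only [hg₁def, h1, one_mul]
  have hg₁val : ∀ V : (GaugeConfig 3 L (Matrix.specialUnitaryGroup (Fin 2) ℂ)), g₁ (coords V) = g (coords V) := fun V => (hg₁ev V).self_of_nhds
  have hg₁gen : ∀ V : (GaugeConfig 3 L (Matrix.specialUnitaryGroup (Fin 2) ℂ)), gen g₁ V = gen g V := fun V => generator_congr_of_eventuallyEq L β' V (hg₁ev V)
  have hg₁fd : ∀ V : (GaugeConfig 3 L (Matrix.specialUnitaryGroup (Fin 2) ℂ)), fderiv ℝ g₁ (coords V) = fderiv ℝ g (coords V) := fun V => (hg₁ev V).fderiv_eq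
  -- derivative of `g`
  have hfd : Differentiable ℝ f := hf.differentiable (by norm_num)
  have hgfd : ∀ (V : (GaugeConfig 3 L (Matrix.specialUnitaryGroup (Fin 2) ℂ))) (v : (Edge 3 L × Fin 2 × Fin 2 × Bool → ℝ)), fderiv ℝ g (coords V) v = Real.exp (l / 2 * f (coords V)) * (l / 2 * fderiv ℝ f (coords V) v) :=
    fun V v => fderiv_exp_const_mul_apply (hfd (coords V)) (l / 2) v
  have hgsq : ∀ V : (GaugeConfig 3 L (Matrix.specialUnitaryGroup (Fin 2) ℂ)), g (coords V) ^ 2 = Real.exp (l * f (coords V)) := by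
    intro V
    rw [hgdef, sq, ← Real.exp_add]
    ring_nf
  -- log-Sobolev for `g`
  have hLS : ρ * ((∫ V, g (coords V) ^ 2 * Real.log (g (coords V) ^ 2) ∂μ) -
      (∫ V, g (coords V) ^ 2 ∂μ) * Real.log (∫ V, g (coords V) ^ 2 ∂μ)) ≤ -∫ V, g (coords V) * gen g V ∂μ :=
    hLSgen g hg
  -- the energy identity for `g₁` and the chain rule for the carré du champ
  have hEn : 2 * ∫ V, g₁ (coords V) * gen g₁ V ∂μ = -∫ V, (∑ i : Edge 3 L × Fin 2 × Fin 2 × Bool, ∑ j : Edge 3 L × Fin 2 × Fin 2 × Bool, fderiv ℝ g₁ (coords V) (Pi.single i 1) * fderiv ℝ g₁ (coords V) (Pi.single j 1) * A V i j) ∂μ :=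
    two_mul_integral_mul_generator_eq_neg_carre L β' hg₁ hg₁c
  have hcarre : ∀ V : (GaugeConfig 3 L (Matrix.specialUnitaryGroup (Fin 2) ℂ)), (∑ i : Edge 3 L × Fin 2 × Fin 2 × Bool, ∑ j : Edge 3 L × Fin 2 × Fin 2 × Bool, fderiv ℝ g₁ (coords V) (Pi.single i 1) * fderiv ℝ g₁ (coords V) (Pi.single j 1) * A V i j) = l ^ 2 / 4 * Real.exp (l * f (coords V)) * (∑ i : Edge 3 L × Fin 2 × Fin 2 × Bool, ∑ j : Edge 3 L × Fin 2 × Fin 2 × Bool, fderiv ℝ f (coords V) (Pi.single i 1) * fderiv ℝ f (coords V) (Pi.single j 1) * A V i j) := by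
    intro V
    rw [Finset.mul_sum]
    refine Finset.sum_congr rfl fun i _ => ?_
    rw [Finset.mul_sum]
    refine Finset.sum_congr rfl fun j _ => ?_
    rw [hg₁fd V, hgfd V, hgfd V]
    have e2 : Real.exp (l / 2 * f (coords V)) * Real.exp (l / 2 * f (coords V)) = Real.exp (l * f (coords V)) := by
      rw [← Real.exp_add]; ring_nf
    calc Real.exp (l / 2 * f (coords V)) * (l / 2 * fderiv ℝ f (coords V) (Pi.single i 1)) *
          (Real.exp (l / 2 * f (coords V)) * (l / 2 * fderiv ℝ f (coords V) (Pi.single j 1))) * A V i j =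
        (Real.exp (l / 2 * f (coords V)) * Real.exp (l / 2 * f (coords V))) *
          (l ^ 2 / 4 * (fderiv ℝ f (coords V) (Pi.single i 1) * fderiv ℝ f (coords V) (Pi.single j 1) * A V i j)) := by ring
      _ = l ^ 2 / 4 * Real.exp (l * f (coords V)) *
          (fderiv ℝ f (coords V) (Pi.single i 1) * fderiv ℝ f (coords V) (Pi.single j 1) * A V i j) := by rw [e2]; ring
  -- continuity of the carré du champ of `f` (for integrability)
  have hreim : ∀ (c : Bool) {φ : (GaugeConfig 3 L (Matrix.specialUnitaryGroup (Fin 2) ℂ)) → ℂ}, Continuous φ → Continuous fun V => (fun z : ℂ => if c then z.im else z.re) (φ V) := by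
    intro c φ hφ; cases c
    · exact Complex.continuous_re.comp hφ
    · exact Complex.continuous_im.comp hφ
  have hnoise : ∀ (i : Edge 3 L × Fin 2 × Fin 2 × Bool) (n : Edge 3 L × NoiseIdx 2), Continuous fun V : (GaugeConfig 3 L (Matrix.specialUnitaryGroup (Fin 2) ℂ)) =>
      (if n.1 = i.1 then (fun z : ℂ => if i.2.2.2 then z.im else z.re)
        ((latticeLangevinDynamics (fundamentalLatticeRep 2) β').noise (matrixConfig (fundamentalRep (Fin 2)) V)
          i.1 n.2 i.2.1 i.2.2.1) else 0) := by
    intro i n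
    by_cases h : n.1 = i.1
    · simp only [if_pos h]
      exact hreim _ ((continuous_apply i.2.2.1).comp ((continuous_apply i.2.1).comp
        (continuous_noise_matrixConfig β' i.1 n.2)))
    · simp only [if_neg h]; exact continuous_const
  have hA : ∀ i j, Continuous fun V : (GaugeConfig 3 L (Matrix.specialUnitaryGroup (Fin 2) ℂ)) => A V i j := fun i j =>
    continuous_finsetSum _ fun n _ => (hnoise i n).mul (hnoise j n)
  have hdf : ∀ v : (Edge 3 L × Fin 2 × Fin 2 × Bool → ℝ), Continuous fun V : (GaugeConfig 3 L (Matrix.specialUnitaryGroup (Fin 2) ℂ)) => fderiv ℝ f (coords V) v := fun v =>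
    ((hf.continuous_fderiv (by norm_num)).clm_apply continuous_const).comp hco
  have hΓc : Continuous fun V : (GaugeConfig 3 L (Matrix.specialUnitaryGroup (Fin 2) ℂ)) => (∑ i : Edge 3 L × Fin 2 × Fin 2 × Bool, ∑ j : Edge 3 L × Fin 2 × Fin 2 × Bool, fderiv ℝ f (coords V) (Pi.single i 1) * fderiv ℝ f (coords V) (Pi.single j 1) * A V i j) :=
    continuous_finsetSum _ fun i _ => continuous_finsetSum _ fun j _ => ((hdf _).mul (hdf _)).mul (hA i j)
  have hEc : Continuous fun V : (GaugeConfig 3 L (Matrix.specialUnitaryGroup (Fin 2) ℂ)) => Real.exp (l * f (coords V)) :=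
    Real.continuous_exp.comp (continuous_const.mul (hf.continuous.comp hco))
  -- `−∫ G 𝓛g ≤ (λ² s / 8) ∫ e^(λF)`
  have hRHS : -∫ V, g (coords V) * gen g V ∂μ ≤ l ^ 2 * s / 8 * ∫ V, Real.exp (l * f (coords V)) ∂μ := by
    have e1 : ∫ V, g (coords V) * gen g V ∂μ = ∫ V, g₁ (coords V) * gen g₁ V ∂μ :=
      integral_congr_ae (ae_of_all _ fun V => by beta_reduce; rw [hg₁val V, hg₁gen V])
    have e2 : -∫ V, g (coords V) * gen g V ∂μ = 1 / 2 * ∫ V, (∑ i : Edge 3 L × Fin 2 × Fin 2 × Bool, ∑ j : Edge 3 L × Fin 2 × Fin 2 × Bool, fderiv ℝ g₁ (coords V) (Pi.single i 1) * fderiv ℝ g₁ (coords V) (Pi.single j 1) * A V i j) ∂μ := by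
      rw [e1]; linarith [hEn]
    rw [e2]
    simp_rw [hcarre]
    have hi1 : Integrable (fun V : (GaugeConfig 3 L (Matrix.specialUnitaryGroup (Fin 2) ℂ)) => l ^ 2 / 4 * Real.exp (l * f (coords V)) * (∑ i : Edge 3 L × Fin 2 × Fin 2 × Bool, ∑ j : Edge 3 L × Fin 2 × Fin 2 × Bool, fderiv ℝ f (coords V) (Pi.single i 1) * fderiv ℝ f (coords V) (Pi.single j 1) * A V i j)) μ :=
      integrable_of_continuous_of_compactSpace ((continuous_const.mul hEc).mul hΓc) _
    have hi2 : Integrable (fun V : (GaugeConfig 3 L (Matrix.specialUnitaryGroup (Fin 2) ℂ)) => l ^ 2 / 4 * Real.exp (l * f (coords V)) * s) μ :=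
      integrable_of_continuous_of_compactSpace ((continuous_const.mul hEc).mul continuous_const) _
    have hmono : ∫ V, l ^ 2 / 4 * Real.exp (l * f (coords V)) * (∑ i : Edge 3 L × Fin 2 × Fin 2 × Bool, ∑ j : Edge 3 L × Fin 2 × Fin 2 × Bool, fderiv ℝ f (coords V) (Pi.single i 1) * fderiv ℝ f (coords V) (Pi.single j 1) * A V i j) ∂μ ≤
        ∫ V, l ^ 2 / 4 * Real.exp (l * f (coords V)) * s ∂μ :=
      integral_mono hi1 hi2 fun V => mul_le_mul_of_nonneg_left (hΓ V) (by positivity)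
    have e3 : ∫ V, l ^ 2 / 4 * Real.exp (l * f (coords V)) * s ∂μ = l ^ 2 / 4 * s * ∫ V, Real.exp (l * f (coords V)) ∂μ := by
      rw [← integral_const_mul]
      exact integral_congr_ae (ae_of_all _ fun V => by ring)
    rw [e3] at hmono
    have hI0 : 0 ≤ ∫ V, Real.exp (l * f (coords V)) ∂μ := integral_nonneg fun V => (Real.exp_pos _).le
    nlinarith [hmono, hI0]
  -- read the log-Sobolev inequality in terms of `e^(λF)`
  have hL1 : ∫ V, g (coords V) ^ 2 * Real.log (g (coords V) ^ 2) ∂μ = ∫ V, (l * f (coords V)) * Real.exp (l * f (coords V)) ∂μ :=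
    integral_congr_ae (ae_of_all _ fun V => by beta_reduce; rw [hgsq V, Real.log_exp, mul_comm])
  have hL2 : ∫ V, g (coords V) ^ 2 ∂μ = ∫ V, Real.exp (l * f (coords V)) ∂μ :=
    integral_congr_ae (ae_of_all _ fun V => by beta_reduce; rw [hgsq V])
  rw [hL1, hL2] at hLS
  have hkey := hLS.trans hRHS
  -- divide by `ρ`
  have e4 : s / (8 * ρ) * l ^ 2 * ∫ V, Real.exp (l * f (coords V)) ∂μ =
      (l ^ 2 * s / 8 * ∫ V, Real.exp (l * f (coords V)) ∂μ) / ρ := by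
    field_simp
  rw [e4, le_div_iff₀ hρ, mul_comm]
  exact hkey


/-! ## §2. Herbst: Laplace transform, log-mgf and concentration -/

/-- ★ **Sub-Gaussian Laplace transform from log-Sobolev(`ρ`)**, `λ ≥ 0`: `∫ e^(λF) dμ_(β') ≤ exp(λ∫F dμ_(β') + sλ²/(8ρ))`. [folklore] -/
theorem wilson_laplace_le_exp_of_logSobolev (L : ℕ) [NeZero L] (β' : ℝ)
    (f : (Edge 3 L × Fin 2 × Fin 2 × Bool → ℝ) → ℝ) (hf : ContDiff ℝ 3 f) {ρ : ℝ} (hρ : 0 < ρ) (s : ℝ)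
    (hLSgen : ∀ (f : (Edge 3 L × Fin 2 × Fin 2 × Bool → ℝ) → ℝ), ContDiff ℝ 3 f →
        let coords : GaugeConfig 3 L (Matrix.specialUnitaryGroup (Fin 2) ℂ) → (Edge 3 L × Fin 2 × Fin 2 × Bool → ℝ) :=
          fun V q => (fun z : ℂ => if q.2.2.2 then z.im else z.re)
            ((fundamentalRep (Fin 2) (V q.1) : Matrix (Fin 2) (Fin 2) ℂ) q.2.1 q.2.2.1)
        let gen : GaugeConfig 3 L (Matrix.specialUnitaryGroup (Fin 2) ℂ) → ℝ := fun V =>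
          (∑ i : Edge 3 L × Fin 2 × Fin 2 × Bool, fderiv ℝ f (coords V) (Pi.single i 1) *
              (fun z : ℂ => if i.2.2.2 then z.im else z.re)
                ((latticeLangevinDynamics (fundamentalLatticeRep 2) β').drift
                  (matrixConfig (fundamentalRep (Fin 2)) V) i.1 i.2.1 i.2.2.1) +
          1 / 2 * ∑ i : Edge 3 L × Fin 2 × Fin 2 × Bool, ∑ j : Edge 3 L × Fin 2 × Fin 2 × Bool,
            fderiv ℝ (fun z => fderiv ℝ f z (Pi.single i 1)) (coords V) (Pi.single j 1) *
              ∑ n : Edge 3 L × NoiseIdx 2,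
                (if n.1 = i.1 then (fun z : ℂ => if i.2.2.2 then z.im else z.re)
                  ((latticeLangevinDynamics (fundamentalLatticeRep 2) β').noise
                    (matrixConfig (fundamentalRep (Fin 2)) V) i.1 n.2 i.2.1 i.2.2.1) else 0) *
                (if n.1 = j.1 then (fun z : ℂ => if j.2.2.2 then z.im else z.re)
                  ((latticeLangevinDynamics (fundamentalLatticeRep 2) β').noise
                    (matrixConfig (fundamentalRep (Fin 2)) V) j.1 n.2 j.2.1 j.2.2.1) else 0))
        ρ * ((∫ V, f (coords V) ^ 2 * Real.log (f (coords V) ^ 2) ∂(wilsonMeasure (d := 3) (L := L) (fundamentalRep (Fin 2)) β')) -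
            (∫ V, f (coords V) ^ 2 ∂(wilsonMeasure (d := 3) (L := L) (fundamentalRep (Fin 2)) β')) *
              Real.log (∫ V, f (coords V) ^ 2 ∂(wilsonMeasure (d := 3) (L := L) (fundamentalRep (Fin 2)) β'))) ≤
          -∫ V, f (coords V) * gen V ∂(wilsonMeasure (d := 3) (L := L) (fundamentalRep (Fin 2)) β')) :
    let coords : GaugeConfig 3 L (Matrix.specialUnitaryGroup (Fin 2) ℂ) → (Edge 3 L × Fin 2 × Fin 2 × Bool → ℝ) :=
      fun V q => (fun z : ℂ => if q.2.2.2 then z.im else z.re)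
        ((fundamentalRep (Fin 2) (V q.1) : Matrix (Fin 2) (Fin 2) ℂ) q.2.1 q.2.2.1)
    let A : GaugeConfig 3 L (Matrix.specialUnitaryGroup (Fin 2) ℂ) → (Edge 3 L × Fin 2 × Fin 2 × Bool) →
        (Edge 3 L × Fin 2 × Fin 2 × Bool) → ℝ := fun V i j =>
      ∑ n : Edge 3 L × NoiseIdx 2,
        (if n.1 = i.1 then (fun z : ℂ => if i.2.2.2 then z.im else z.re)
          ((latticeLangevinDynamics (fundamentalLatticeRep 2) β').noise
            (matrixConfig (fundamentalRep (Fin 2)) V) i.1 n.2 i.2.1 i.2.2.1) else 0) *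
        (if n.1 = j.1 then (fun z : ℂ => if j.2.2.2 then z.im else z.re)
          ((latticeLangevinDynamics (fundamentalLatticeRep 2) β').noise
            (matrixConfig (fundamentalRep (Fin 2)) V) j.1 n.2 j.2.1 j.2.2.1) else 0)
    (∀ V, (∑ i : Edge 3 L × Fin 2 × Fin 2 × Bool, ∑ j : Edge 3 L × Fin 2 × Fin 2 × Bool, fderiv ℝ f (coords V) (Pi.single i 1) * fderiv ℝ f (coords V) (Pi.single j 1) * A V i j) ≤ s) → ∀ l : ℝ, 0 ≤ l →
      ∫ V, Real.exp (l * f (coords V)) ∂(wilsonMeasure (d := 3) (L := L) (fundamentalRep (Fin 2)) β') ≤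
        Real.exp (l * (∫ V, f (coords V) ∂(wilsonMeasure (d := 3) (L := L) (fundamentalRep (Fin 2)) β')) + s / (8 * ρ) * l ^ 2) := by
  intro coords A hΓ l hl
  classical
  haveI := secondCountableTopology_su2
  haveI := borelSpace_config L
  haveI : IsProbabilityMeasure (wilsonMeasure (d := 3) (L := L) (fundamentalRep (Fin 2)) β') :=
    isProbabilityMeasure_wilsonMeasure (d := 3) (L := L) (fundamentalRep (Fin 2)) (continuous_fundamentalRep (Fin 2)) β'
  have hco : Continuous coords := continuous_coords (L := L)
  have hFc : Continuous fun V => f (coords V) := hf.continuous.comp hco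
  obtain ⟨M, hM⟩ : ∃ M, ∀ V : (GaugeConfig 3 L (Matrix.specialUnitaryGroup (Fin 2) ℂ)), |f (coords V)| ≤ M := by
    obtain ⟨M, hM⟩ := isCompact_univ.exists_bound_of_continuousOn hFc.continuousOn
    exact ⟨M, fun V => by simpa [Real.norm_eq_abs] using hM V (Set.mem_univ V)⟩
  exact integral_exp_mul_le_of_entropy_le (wilsonMeasure (d := 3) (L := L) (fundamentalRep (Fin 2)) β') hFc.measurable hM
    (fun l' hl' => wilson_entropy_exp_le_of_logSobolev L β' f hf s hρ hLSgen hΓ l' hl') hl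

/-- ★ **Two-sided sub-Gaussian Laplace transform from log-Sobolev(`ρ`)**, every real `λ` (apply the one-sided bound to `−f`, which has the
same carré du champ). [folklore] -/
theorem wilson_laplace_le_exp_of_logSobolev_real (L : ℕ) [NeZero L] (β' : ℝ) (s : ℝ)
    (f : (Edge 3 L × Fin 2 × Fin 2 × Bool → ℝ) → ℝ) (hf : ContDiff ℝ 3 f) {ρ : ℝ} (hρ : 0 < ρ)
    (hLSgen : ∀ (f : (Edge 3 L × Fin 2 × Fin 2 × Bool → ℝ) → ℝ), ContDiff ℝ 3 f →
        let coords : GaugeConfig 3 L (Matrix.specialUnitaryGroup (Fin 2) ℂ) → (Edge 3 L × Fin 2 × Fin 2 × Bool → ℝ) :=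
          fun V q => (fun z : ℂ => if q.2.2.2 then z.im else z.re)
            ((fundamentalRep (Fin 2) (V q.1) : Matrix (Fin 2) (Fin 2) ℂ) q.2.1 q.2.2.1)
        let gen : GaugeConfig 3 L (Matrix.specialUnitaryGroup (Fin 2) ℂ) → ℝ := fun V =>
          (∑ i : Edge 3 L × Fin 2 × Fin 2 × Bool, fderiv ℝ f (coords V) (Pi.single i 1) *
              (fun z : ℂ => if i.2.2.2 then z.im else z.re)
                ((latticeLangevinDynamics (fundamentalLatticeRep 2) β').drift
                  (matrixConfig (fundamentalRep (Fin 2)) V) i.1 i.2.1 i.2.2.1) +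
          1 / 2 * ∑ i : Edge 3 L × Fin 2 × Fin 2 × Bool, ∑ j : Edge 3 L × Fin 2 × Fin 2 × Bool,
            fderiv ℝ (fun z => fderiv ℝ f z (Pi.single i 1)) (coords V) (Pi.single j 1) *
              ∑ n : Edge 3 L × NoiseIdx 2,
                (if n.1 = i.1 then (fun z : ℂ => if i.2.2.2 then z.im else z.re)
                  ((latticeLangevinDynamics (fundamentalLatticeRep 2) β').noise
                    (matrixConfig (fundamentalRep (Fin 2)) V) i.1 n.2 i.2.1 i.2.2.1) else 0) *
                (if n.1 = j.1 then (fun z : ℂ => if j.2.2.2 then z.im else z.re)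
                  ((latticeLangevinDynamics (fundamentalLatticeRep 2) β').noise
                    (matrixConfig (fundamentalRep (Fin 2)) V) j.1 n.2 j.2.1 j.2.2.1) else 0))
        ρ * ((∫ V, f (coords V) ^ 2 * Real.log (f (coords V) ^ 2) ∂(wilsonMeasure (d := 3) (L := L) (fundamentalRep (Fin 2)) β')) -
            (∫ V, f (coords V) ^ 2 ∂(wilsonMeasure (d := 3) (L := L) (fundamentalRep (Fin 2)) β')) *
              Real.log (∫ V, f (coords V) ^ 2 ∂(wilsonMeasure (d := 3) (L := L) (fundamentalRep (Fin 2)) β'))) ≤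
          -∫ V, f (coords V) * gen V ∂(wilsonMeasure (d := 3) (L := L) (fundamentalRep (Fin 2)) β')) :
    let coords : GaugeConfig 3 L (Matrix.specialUnitaryGroup (Fin 2) ℂ) → (Edge 3 L × Fin 2 × Fin 2 × Bool → ℝ) :=
      fun V q => (fun z : ℂ => if q.2.2.2 then z.im else z.re)
        ((fundamentalRep (Fin 2) (V q.1) : Matrix (Fin 2) (Fin 2) ℂ) q.2.1 q.2.2.1)
    let A : GaugeConfig 3 L (Matrix.specialUnitaryGroup (Fin 2) ℂ) → (Edge 3 L × Fin 2 × Fin 2 × Bool) →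
        (Edge 3 L × Fin 2 × Fin 2 × Bool) → ℝ := fun V i j =>
      ∑ n : Edge 3 L × NoiseIdx 2,
        (if n.1 = i.1 then (fun z : ℂ => if i.2.2.2 then z.im else z.re)
          ((latticeLangevinDynamics (fundamentalLatticeRep 2) β').noise
            (matrixConfig (fundamentalRep (Fin 2)) V) i.1 n.2 i.2.1 i.2.2.1) else 0) *
        (if n.1 = j.1 then (fun z : ℂ => if j.2.2.2 then z.im else z.re)
          ((latticeLangevinDynamics (fundamentalLatticeRep 2) β').noise
            (matrixConfig (fundamentalRep (Fin 2)) V) j.1 n.2 j.2.1 j.2.2.1) else 0)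
    (∀ V, (∑ i : Edge 3 L × Fin 2 × Fin 2 × Bool, ∑ j : Edge 3 L × Fin 2 × Fin 2 × Bool, fderiv ℝ f (coords V) (Pi.single i 1) * fderiv ℝ f (coords V) (Pi.single j 1) * A V i j) ≤ s) → ∀ l : ℝ,
      ∫ V, Real.exp (l * f (coords V)) ∂(wilsonMeasure (d := 3) (L := L) (fundamentalRep (Fin 2)) β') ≤
        Real.exp (l * (∫ V, f (coords V) ∂(wilsonMeasure (d := 3) (L := L) (fundamentalRep (Fin 2)) β')) + s / (8 * ρ) * l ^ 2) := by
  intro coords A hΓ l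
  rcases le_or_gt 0 l with hl | hl
  · exact wilson_laplace_le_exp_of_logSobolev L β' f hf hρ s hLSgen hΓ l hl
  · have hg : ContDiff ℝ 3 (fun z => -f z) := hf.neg
    have hΓg : ∀ V, (∑ i : Edge 3 L × Fin 2 × Fin 2 × Bool, ∑ j : Edge 3 L × Fin 2 × Fin 2 × Bool, fderiv ℝ (fun z => -f z) (coords V) (Pi.single i 1) * fderiv ℝ (fun z => -f z) (coords V) (Pi.single j 1) * A V i j) ≤ s := by
      intro V
      have e : (∑ i : Edge 3 L × Fin 2 × Fin 2 × Bool, ∑ j : Edge 3 L × Fin 2 × Fin 2 × Bool, fderiv ℝ (fun z => -f z) (coords V) (Pi.single i 1) * fderiv ℝ (fun z => -f z) (coords V) (Pi.single j 1) * A V i j) =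
          (∑ i : Edge 3 L × Fin 2 × Fin 2 × Bool, ∑ j : Edge 3 L × Fin 2 × Fin 2 × Bool, fderiv ℝ f (coords V) (Pi.single i 1) * fderiv ℝ f (coords V) (Pi.single j 1) * A V i j) := by
        refine Finset.sum_congr rfl fun i _ => Finset.sum_congr rfl fun j _ => ?_
        rw [fderiv_fun_neg]
        simp only [neg_apply]
        ring
      rw [e]
      exact hΓ V
    have h := wilson_laplace_le_exp_of_logSobolev L β' (fun z => -f z) hg hρ s hLSgen hΓg (-l) (by linarith)
    calc ∫ V, Real.exp (l * f (coords V)) ∂(wilsonMeasure (d := 3) (L := L) (fundamentalRep (Fin 2)) β')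
        = ∫ V, Real.exp (-l * (fun z => -f z) (coords V)) ∂(wilsonMeasure (d := 3) (L := L) (fundamentalRep (Fin 2)) β') := by
          refine integral_congr_ae (ae_of_all _ fun V => ?_)
          beta_reduce
          congr 1
          ring
      _ ≤ Real.exp (-l * (∫ V, (fun z => -f z) (coords V) ∂(wilsonMeasure (d := 3) (L := L) (fundamentalRep (Fin 2)) β')) + s / (8 * ρ) * (-l) ^ 2) := h
      _ = Real.exp (l * (∫ V, f (coords V) ∂(wilsonMeasure (d := 3) (L := L) (fundamentalRep (Fin 2)) β')) + s / (8 * ρ) * l ^ 2) := by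
          congr 1
          beta_reduce
          rw [integral_neg]
          ring

end Summit.QuantumFields.YangMills.Theorems.ColdStartUniversality
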